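import Summits.Ventures.PercRepro.MSTightRemovableCount
import Summits.Ventures.PercRepro.MSTightRStarM

/-!
# (SING-t) at a removable tight-trace element, part III: Propositions 1–2, the fibre instance,
# and the theorem

Dossier proofs/MINE1-theoremS.md, Addendum 36 (the removable case: (R2)–(R3), Propositions 1–2),
Addendum 37 §1 (the fibre instance over `u_N`) and Addendum 41. In a removable Case I datum
(MSTightRemovableSetup.lean) with `P = proj r F`, `D = D(P)`, `R = R*(P)`, `K` the partner
family, `u₁ = u.erase r`, `u_N = u₁ ∖ R`, `u_M = u₁ ∩ R`, `ū = univ ∖ u`: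
* every member through `r` is C*-signable (`cells_C_of_mem_partner`) and the C*-cells
  `p ∖ u₁`, `u₁ ∖ p` of every trace member lie in `D` (`sdiff_erase_mem_diffs`,
  `erase_sdiff_mem_diffs`);
* **Proposition 1** (`compl_sdiff_Rstar_mem_diffs`): `ū ∖ R ∈ D`, else every member of `F` is
  C*-signable and `F ∪ {u}` is tight; hence `u_M ∉ D` (`erase_inter_Rstar_notMem_diffs`, as
  `ū ∉ P`) and **(R3)** `u_N ∈ Y` (`erase_sdiff_Rstar_mem_diffsY`: the top member `R` is not
  A-signable);
* **the fibre instance** `fibInst : RInst R (D ∩ 2^R) (fibT F r u) u_M` — (Cnt) is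
  `card_faces_le` (MSTightRemovableCount.lean), (Sig) comes from the signability of the members
  `R ∖ v`, (AO) from a member that is not C*-signable (`F ∪ {u}` not tight);
* **Proposition 2 and Theorem (R*-M) proper** (`RemovableData.false`): the witness `k ∩ R ∈ D`
  of the fibre instance makes `S' ∖ k ∈ P` a member complementary to `insert r k` — against
  validity. Hence **(SING-t) at a removable element in Case I**
  (`singleton_mem_or_erase_mem_of_removable`).
-/

namespace PercRepro.MSTight

open Finset
open scoped FinsetFamily

variable {α : Type*} [DecidableEq α] [Fintype α]

/-- The disagreement cells of `u` at `t`, written with set differences. -/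
theorem cells_compl_iff' {D : Finset (Finset α)} {t u : Finset α} :
    Cells D t (univ \ u) ↔ t \ u ∈ D ∧ u \ t ∈ D := by
  unfold Cells
  have e1 : t ∩ (univ \ u) = t \ u := by
    ext a; simp only [mem_inter, mem_sdiff, mem_univ, true_and]
  have e2 : (univ \ t) ∩ (univ \ (univ \ u)) = u \ t := by
    ext a; simp only [mem_inter, mem_sdiff, mem_univ, true_and, not_not]; tauto
  rw [e1, e2]

namespace RemovableData

variable {F : Finset (Finset α)} {r : α} {u : Finset α}

/-- `u₁ ∖ R ∈ D` and `R ∖ u₁ ∈ D` (`u₁ ∈ P`). -/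
theorem erase_parts (d : RemovableData F r u) :
    u.erase r \ Rstar (proj r F) ∈ proj r F \\ proj r F ∧
      Rstar (proj r F) \ u.erase r ∈ proj r F \\ proj r F :=
  (mem_iff_parts d.hP).1 d.erase_mem_proj

/-- The automatic C*-cell of Case I: `p ∖ u₁ ∈ D` for every trace member `p`. -/
theorem sdiff_erase_mem_diffs (d : RemovableData F r u) {p : Finset α} (hp : p ∈ proj r F) :
    p \ u.erase r ∈ proj r F \\ proj r F := by
  have hD := d.isDownSet_diffs_proj
  obtain ⟨hpN, -⟩ := (mem_iff_parts d.hP).1 hp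
  rw [mem_diffs_iff_parts d.hP hD]
  constructor
  · exact hD _ hpN _ (sdiff_subset_sdiff sdiff_subset (subset_refl _))
  · refine hD _ d.erase_parts.2 _ ?_
    intro a ha
    rw [mem_inter, mem_sdiff] at ha
    exact mem_sdiff.2 ⟨ha.2, ha.1.2⟩

/-- The other automatic C*-cell of Case I: `u₁ ∖ p ∈ D` for every trace member `p`. -/
theorem erase_sdiff_mem_diffs (d : RemovableData F r u) {p : Finset α} (hp : p ∈ proj r F) :
    u.erase r \ p ∈ proj r F \\ proj r F := by
  have hD := d.isDownSet_diffs_proj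
  obtain ⟨-, hpR⟩ := (mem_iff_parts d.hP).1 hp
  rw [mem_diffs_iff_parts d.hP hD]
  constructor
  · exact hD _ d.erase_parts.1 _ (sdiff_subset_sdiff sdiff_subset (subset_refl _))
  · refine hD _ hpR _ ?_
    intro a ha
    rw [mem_inter, mem_sdiff] at ha
    exact mem_sdiff.2 ⟨ha.2, ha.1.2⟩

/-- A difference of the trace is a difference of `F`. -/
theorem mem_diffs_of_mem_diffs_proj (d : RemovableData F r u) {z : Finset α}
    (hz : z ∈ proj r F \\ proj r F) : z ∈ F \\ F := by
  rw [← d.diffsX_eq] at hz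
  exact (mem_diffsX_iff.1 hz).1

/-- **(R2).** Every member through `r` is C*-signable. -/
theorem cells_C_of_mem_partner (d : RemovableData F r u) {k : Finset α} (hk : k ∈ partner r F) :
    Cells (F \\ F) (insert r k) (univ \ u) := by
  have hrk := d.notMem_of_mem_partner hk
  have hkP := d.mem_proj_of_mem_partner hk
  rw [cells_compl_iff']
  have e1 : insert r k \ u = k \ u.erase r := by
    ext a
    simp only [mem_sdiff, mem_insert, mem_erase, not_and]
    constructor
    · rintro ⟨rfl | hak, hau⟩
      · exact absurd d.hru hau
      · exact ⟨hak, fun _ => hau⟩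
    · rintro ⟨hak, h⟩
      exact ⟨Or.inr hak, fun hau => h (fun har => hrk (har ▸ hak)) hau⟩
  have e2 : u \ insert r k = u.erase r \ k := by
    ext a
    simp only [mem_sdiff, mem_insert, mem_erase, not_or]
    tauto
  rw [e1, e2]
  exact ⟨d.mem_diffs_of_mem_diffs_proj (d.sdiff_erase_mem_diffs hkP),
    d.mem_diffs_of_mem_diffs_proj (d.erase_sdiff_mem_diffs hkP)⟩

/-- A member of `F` through `r` is `insert r k` for a partner member `k`. -/
theorem erase_mem_partner_of_mem (d : RemovableData F r u) {t : Finset α} (ht : t ∈ F)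
    (hrt : r ∈ t) : t.erase r ∈ partner r F := by
  rw [d.partner_eq_partr]
  exact mem_partr.2 ⟨notMem_erase r t, by rw [insert_erase hrt]; exact ht⟩

/-- The `N`-truncation `((p ∖ R) ∩ u₁) ∪ (p ∩ R)` of a trace member is a trace member ((R4)). -/
theorem trunc_mem_proj (d : RemovableData F r u) {p : Finset α} (hp : p ∈ proj r F) :
    ((p \ Rstar (proj r F)) ∩ u.erase r) ∪ (p ∩ Rstar (proj r F)) ∈ proj r F := by
  have hD := d.isDownSet_diffs_proj
  obtain ⟨hpN, hpR⟩ := (mem_iff_parts d.hP).1 hp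
  rw [mem_iff_parts d.hP]
  constructor
  · have : (((p \ Rstar (proj r F)) ∩ u.erase r) ∪ (p ∩ Rstar (proj r F))) \ Rstar (proj r F) =
        (p \ Rstar (proj r F)) ∩ u.erase r := by
      ext a; simp only [mem_sdiff, mem_union, mem_inter]; tauto
    rw [this]
    exact hD _ hpN _ inter_subset_left
  · have : Rstar (proj r F) \ (((p \ Rstar (proj r F)) ∩ u.erase r) ∪ (p ∩ Rstar (proj r F))) =
        Rstar (proj r F) \ p := by
      ext a; simp only [mem_sdiff, mem_union, mem_inter, not_or, not_and]; tauto
    rw [this]; exact hpR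

/-- **Proposition 1 (Sub-case I.2 is impossible).** `ū ∖ R ∈ D`: otherwise every member of `F` is
C*-signable, i.e. `F ∪ {u}` is tight. -/
theorem compl_sdiff_Rstar_mem_diffs (d : RemovableData F r u) :
    (univ \ u) \ Rstar (proj r F) ∈ proj r F \\ proj r F := by
  by_contra hN
  apply d.hnt
  rw [tight_insert_iff_of_excess_one d.hexc d.hu]
  intro t ht
  have hD := d.isDownSet_diffs_proj
  by_cases hrt : r ∈ t
  · -- a member through `r`: C*-signable by (R2)
    have hC := d.cells_C_of_mem_partner (d.erase_mem_partner_of_mem ht hrt)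
    rw [insert_erase hrt, cells_compl_iff'] at hC
    exact ⟨hC.2, hC.1⟩
  · -- a trace member `p = t`: its truncation `p'` is not A-signable, hence C*-signable
    have hp : t ∈ proj r F := mem_proj.2 ⟨t, ht, erase_eq_of_notMem hrt⟩
    set p' := ((t \ Rstar (proj r F)) ∩ u.erase r) ∪ (t ∩ Rstar (proj r F)) with hp'
    have hp'P : p' ∈ proj r F := d.trunc_mem_proj hp
    have hp'F : p' ∈ F := d.mem_of_mem_proj hp'P
    have hsub : (univ \ u) \ Rstar (proj r F) ⊆ (univ \ u) \ p' := by
      intro a ha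
      rw [mem_sdiff, mem_sdiff] at ha
      refine mem_sdiff.2 ⟨mem_sdiff.2 ha.1, ?_⟩
      rw [hp', mem_union, mem_inter, mem_inter, mem_sdiff, mem_erase]
      rintro (⟨-, -, hau⟩ | ⟨-, haR⟩)
      · exact ha.1.2 hau
      · exact ha.2 haR
    have hnotA : ¬ Cells (F \\ F) p' u := by
      rw [d.cells_A_iff hp'P]
      rintro ⟨-, h⟩
      exact hN (hD _ h _ hsub)
    have hC : Cells (F \\ F) p' (univ \ u) := (d.hsig p' hp'F).resolve_left hnotA
    rw [d.cells_C_iff hp'P] at hC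
    have heq : u.erase r \ p' = u.erase r \ t := by
      ext a
      rw [hp']
      simp only [mem_sdiff, mem_union, mem_inter, mem_erase, not_or, not_and]
      tauto
    rw [heq] at hC
    -- so `t` is C*-signable
    have hCt : Cells (F \\ F) t (univ \ u) := by
      rw [d.cells_C_iff hp]
      exact ⟨d.sdiff_erase_mem_diffs hp, hC.2⟩
    rw [cells_compl_iff'] at hCt
    exact ⟨hCt.2, hCt.1⟩

/-- **Sub-case I.1.** `u_M = u₁ ∩ R ∉ D` (else `ū ∈ P`). -/
theorem erase_inter_Rstar_notMem_diffs (d : RemovableData F r u) :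
    u.erase r ∩ Rstar (proj r F) ∉ proj r F \\ proj r F := by
  intro h
  apply d.compl_notMem_proj
  rw [mem_iff_parts d.hP]
  refine ⟨d.compl_sdiff_Rstar_mem_diffs, ?_⟩
  have hRS := d.Rstar_subset_erase
  have : Rstar (proj r F) \ (univ \ u) = u.erase r ∩ Rstar (proj r F) := by
    ext a
    simp only [mem_sdiff, mem_univ, true_and, not_not, mem_inter, mem_erase]
    constructor
    · rintro ⟨haR, hau⟩
      exact ⟨⟨(mem_erase.1 (hRS haR)).1, hau⟩, haR⟩
    · rintro ⟨⟨-, hau⟩, haR⟩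
      exact ⟨haR, hau⟩
  rw [this]; exact h

/-- **(R3).** `u_N = u₁ ∖ R ∈ Y`: the top member `R` is not A-signable, hence C*-signable. -/
theorem erase_sdiff_Rstar_mem_diffsY (d : RemovableData F r u) :
    u.erase r \ Rstar (proj r F) ∈ diffsY r F := by
  have hRP := d.Rstar_mem_proj
  have hRF := d.mem_of_mem_proj hRP
  rcases d.hsig _ hRF with hA | hC
  · exfalso
    rw [d.cells_A_iff hRP] at hA
    apply d.erase_inter_Rstar_notMem_diffs
    rw [inter_comm]; exact hA.1
  · rw [d.cells_C_iff hRP] at hC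
    exact hC.2

/-- The fibre family is nonempty: some partner member contains `u_N`. -/
theorem fibT_nonempty (d : RemovableData F r u) : (fibT F r u).Nonempty := by
  obtain ⟨-, k, hk, hNk⟩ := d.mem_diffsY_iff_faces.1 d.erase_sdiff_Rstar_mem_diffsY
  exact ⟨k ∩ Rstar (proj r F), mem_fibT.2 ⟨k, hk, hNk, rfl⟩⟩

/-- Every singleton of `R` is a difference of the trace. -/
theorem singleton_mem_diffs_of_mem_Rstar (d : RemovableData F r u) {a : α}
    (ha : a ∈ Rstar (proj r F)) : ({a} : Finset α) ∈ proj r F \\ proj r F :=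
  d.singleton_mem_diffs (mem_erase.1 (d.Rstar_subset_erase ha)).1

/-- **The fibre instance** `(R, D ∩ 2^R, T, u_M)` of Addendum 37 §1 is an instance of (R*-M). -/
theorem fibInst (d : RemovableData F r u) :
    RInst (Rstar (proj r F)) ((proj r F \\ proj r F).filter fun w => w ⊆ Rstar (proj r F))
      (fibT F r u) (u.erase r ∩ Rstar (proj r F)) where
  hdown := by
    intro w hw w' hw'
    obtain ⟨hwD, hwR⟩ := mem_filter.1 hw
    exact mem_filter.2 ⟨d.isDownSet_diffs_proj _ hwD _ hw', hw'.trans hwR⟩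
  hLS := fun w hw => (mem_filter.1 hw).2
  hsing := fun a ha => mem_filter.2 ⟨d.singleton_mem_diffs_of_mem_Rstar ha, singleton_subset_iff.2 ha⟩
  hS := fun h => d.Rstar_notMem_diffs (mem_filter.1 h).1
  hne := d.fibT_nonempty
  hTS := by
    intro y hy
    obtain ⟨k, -, -, rfl⟩ := mem_fibT.1 hy
    exact inter_subset_right
  hTU := by
    intro y hy
    obtain ⟨k, hk, -, rfl⟩ := mem_fibT.1 hy
    rw [sdiff_inter_self_right]
    exact mem_filter.2 ⟨((mem_iff_parts d.hP).1 (d.mem_proj_of_mem_partner hk)).2, sdiff_subset⟩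
  hcnt := d.card_faces_le
  huS := inter_subset_right
  hu := fun h => d.erase_inter_Rstar_notMem_diffs (mem_filter.1 h).1
  huU := by
    rw [sdiff_inter_self_right]
    exact mem_filter.2 ⟨d.erase_parts.2, sdiff_subset⟩
  hsig := by
    intro v hv hvu
    obtain ⟨hvD, hvR⟩ := mem_filter.1 hv
    have hD := d.isDownSet_diffs_proj
    -- the member `y = R ∖ v`
    have hyP : (∅ : Finset α) ∪ (Rstar (proj r F) \ v) ∈ proj r F :=
      union_sdiff_mem d.hP (hD _ hvD _ (empty_subset _)) (disjoint_empty_left _) hvD hvR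
    rw [empty_union] at hyP
    have hyF := d.mem_of_mem_proj hyP
    rcases d.hsig _ hyF with hA | hC
    · left
      rw [d.cells_A_iff hyP] at hA
      have : (Rstar (proj r F) \ v) ∩ u.erase r = (u.erase r ∩ Rstar (proj r F)) \ v := by
        ext a; simp only [mem_inter, mem_sdiff]; tauto
      rw [this] at hA
      exact mem_filter.2 ⟨hA.1, sdiff_subset.trans inter_subset_right⟩
    · right
      rw [d.cells_C_iff hyP] at hC
      obtain ⟨-, k, hk, hsub⟩ := d.mem_diffsY_iff_faces.1 hC.2
      refine ⟨k ∩ Rstar (proj r F), mem_fibT.2 ⟨k, hk, ?_, rfl⟩, ?_⟩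
      · refine (sdiff_subset_sdiff (subset_refl _) sdiff_subset).trans hsub
      · intro a hav
        refine mem_inter.2 ⟨hsub ?_, hvR hav⟩
        exact mem_sdiff.2 ⟨(mem_inter.1 (hvu hav)).1, fun h => (mem_sdiff.1 h).2 hav⟩
  hao := by
    -- a member that is not C*-signable
    have hex : ∃ t ∈ F, ¬ (u \ t ∈ F \\ F ∧ t \ u ∈ F \\ F) := by
      by_contra h
      push Not at h
      exact d.hnt ((tight_insert_iff_of_excess_one d.hexc d.hu).2 h)
    obtain ⟨t, ht, hnotC⟩ := hex
    have hnotC' : ¬ Cells (F \\ F) t (univ \ u) := by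
      rw [cells_compl_iff']; tauto
    have hrt : r ∉ t := by
      intro hrt
      apply hnotC'
      have := d.cells_C_of_mem_partner (d.erase_mem_partner_of_mem ht hrt)
      rwa [insert_erase hrt] at this
    have hp : t ∈ proj r F := mem_proj.2 ⟨t, ht, erase_eq_of_notMem hrt⟩
    have hA : Cells (F \\ F) t u := (d.hsig t ht).resolve_right hnotC'
    rw [d.cells_A_iff hp] at hA
    have hnotY : u.erase r \ t ∉ diffsY r F := by
      intro hY
      apply hnotC'
      rw [d.cells_C_iff hp]
      exact ⟨d.sdiff_erase_mem_diffs hp, hY⟩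
    have hD := d.isDownSet_diffs_proj
    obtain ⟨-, htR⟩ := (mem_iff_parts d.hP).1 hp
    refine ⟨(u.erase r ∩ Rstar (proj r F)) \ t, ?_, sdiff_subset, ?_, ?_⟩
    · refine mem_filter.2 ⟨hD _ htR _ ?_, sdiff_subset.trans inter_subset_right⟩
      intro a ha
      rw [mem_sdiff, mem_inter] at ha
      exact mem_sdiff.2 ⟨ha.1.2, ha.2⟩
    · have : (u.erase r ∩ Rstar (proj r F)) \ ((u.erase r ∩ Rstar (proj r F)) \ t) =
          (u.erase r ∩ Rstar (proj r F)) ∩ t := by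
        rw [sdiff_sdiff_right_self, inf_eq_inter]
      rw [this]
      refine mem_filter.2 ⟨hD _ hA.1 _ ?_, inter_subset_left.trans inter_subset_right⟩
      intro a ha
      rw [mem_inter, mem_inter] at ha
      exact mem_inter.2 ⟨ha.2, ha.1.1⟩
    · intro y hy hsub
      obtain ⟨k, hk, hNk, rfl⟩ := mem_fibT.1 hy
      apply hnotY
      rw [d.mem_diffsY_iff_faces]
      refine ⟨d.erase_sdiff_mem_diffs hp, k, hk, ?_⟩
      intro a ha
      obtain ⟨hau, hat⟩ := mem_sdiff.1 ha
      by_cases haR : a ∈ Rstar (proj r F)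
      · exact (mem_inter.1 (hsub (mem_sdiff.2 ⟨mem_inter.2 ⟨hau, haR⟩, hat⟩))).1
      · exact hNk (mem_sdiff.2 ⟨hau, haR⟩)

/-- **Proposition 2 + Theorem (R*-M) proper.** A removable Case I datum at a genuine tight trace
does not exist: the witness of the fibre instance is a partner member `k` over `u_N` with
`k ∩ R ∈ D`, and then `S' ∖ k ∈ P` is a member complementary to `insert r k`. -/
theorem false (d : RemovableData F r u) : False := by
  obtain ⟨y, hy, hyL⟩ := d.fibInst.exists_witness
  obtain ⟨k, hk, hNk, rfl⟩ := mem_fibT.1 hy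
  have hkR : k ∩ Rstar (proj r F) ∈ proj r F \\ proj r F := (mem_filter.1 hyL).1
  have hD := d.isDownSet_diffs_proj
  have hRS := d.Rstar_subset_erase
  have hrk := d.notMem_of_mem_partner hk
  -- `S' ∖ k ∈ P`
  have hcP : univ.erase r \ k ∈ proj r F := by
    rw [mem_iff_parts d.hP]
    constructor
    · refine hD _ d.compl_sdiff_Rstar_mem_diffs _ ?_
      intro a ha
      rw [mem_sdiff, mem_sdiff, mem_erase] at ha
      refine mem_sdiff.2 ⟨mem_sdiff.2 ⟨mem_univ a, fun hau => ?_⟩, ha.2⟩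
      exact ha.1.2 (hNk (mem_sdiff.2 ⟨mem_erase.2 ⟨ha.1.1.1, hau⟩, ha.2⟩))
    · have : Rstar (proj r F) \ (univ.erase r \ k) = k ∩ Rstar (proj r F) := by
        ext a
        constructor
        · intro ha
          obtain ⟨haR, hac⟩ := mem_sdiff.1 ha
          refine mem_inter.2 ⟨?_, haR⟩
          by_contra hak
          exact hac (mem_sdiff.2 ⟨hRS haR, hak⟩)
        · intro ha
          obtain ⟨hak, haR⟩ := mem_inter.1 ha
          exact mem_sdiff.2 ⟨haR, fun h => (mem_sdiff.1 h).2 hak⟩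
      rw [this]; exact hkR
  have hcF := d.mem_of_mem_proj hcP
  have hkF := d.insert_mem_of_mem_partner hk
  apply d.hvalid _ hkF
  have : univ \ insert r k = univ.erase r \ k := by
    ext a
    simp only [mem_sdiff, mem_univ, true_and, mem_insert, not_or, mem_erase]
    tauto
  rw [this]; exact hcF

end RemovableData

/-- **(SING-t) at a removable element in Case I.** In a residue instance `(F, u)` with
`F ∪ {u}` not tight, a removable element `r ∈ u` with a tight trace and `u ∖ r ∈ F` has
`{r} ∈ F` or `univ ∖ r ∈ F`. -/
theorem singleton_mem_or_erase_mem_of_removable {F : Finset (Finset α)} {r : α} {u : Finset α}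
    (hexc : (F \\ F).card = F.card + 1) (hP : Tight (proj r F)) (htf : ∀ a b, Twin F a b → a = b)
    (hcore : ∀ a, ∃ t ∈ F, a ∉ t) (hsupp : ∀ a, ∃ t ∈ F, a ∈ t) (hempty : (∅ : Finset α) ∉ F)
    (huniv : (univ : Finset α) ∉ F) (hvalid : ∀ t ∈ F, univ \ t ∉ F) (hu : u ∉ F)
    (hu' : univ \ u ∉ F) (hsig : ∀ t ∈ F, Cells (F \\ F) t u ∨ Cells (F \\ F) t (univ \ u))
    (hnt : ¬ Tight (insert u F)) (hru : r ∈ u) (hrem : partr r F ⊆ part0 r F)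
    (hI : u.erase r ∈ F) : ({r} : Finset α) ∈ F ∨ univ.erase r ∈ F := by
  by_contra h
  push Not at h
  exact RemovableData.false ⟨hexc, hP, htf, hcore, hsupp, hempty, huniv, hvalid, hu, hu', hsig, hnt,
    hru, hrem, hI, h.1, h.2⟩

end PercRepro.MSTight
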